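import Summits.Ventures.Crystal3D.Theorems.StickyWulffConstantCoaxialWallLawIncoherentCount
import HarnessLib

/-!
# Incoherent translation pairs (class (A)), RIGID fillings III: `stub_coaxialTwoSlabAdhesion`'s inequality at `½`
# (indeed at `φ₁`: the bottom grain recovers nothing) — no census, no kissing facts

HONEST FRAMING. Part of the venture `Summits/Ventures/Crystal3D` (cell `crystal3d-full`), helper
`--supports` the crux `CoaxialWallLaw` (stmt-Ventures-19481, `route-Ventures-StickyWulffConstant`),
REGISTERED line `WallLedgerF` (planner cf-p1), open stub `stub_coaxialTwoSlabAdhesion`.  Rung credit only;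
F-C1 not moved.  Memo HOME/wall-19481-p2/F-TWOPLATE-g5.md §3.

THE CLASS.  A translation pair `Λ₁ = A₁·Λ₀ + t₁`, `Λ₂ = A₂·Λ₀ + t₂` (`A₁·Λ₀ = A₂·Λ₀`) whose offset
`τ = A₁⁻¹(t₂ − t₁)` is INCOHERENT — `‖q + τ‖ ≠ 1` for all `q ∈ Λ₀`, i.e. `τ ∉ Λ₀ + S²`: the two grains never
touch (`movedFcc_dist_ne_one_of_coset`).  This holds for every offset off the measure-zero set `Λ₀ + S²` (a
countable union of unit spheres) — so for GENERIC translation pairs — and, by `allInt_norm_add_ne_one`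
(`…IncoherentOffset`), for all of class (A) of the skew trichotomy (the octahedral / tetrahedral-hole cosets); the
coherent exceptions inside classes (B)/(C) are the `{111}` fault-vector cosets (stacking-fault terraces touch).
19481-p1's on-site / laminar `½`-rungs need a common SITE lattice and lane G's stack ledger needs distinct LINEAR
lattices; an incoherent translation pair has neither, and its census-free record was the word lane's `φ₁/39`
(`…PayerTransTwoPlate`) resp. `(√6/78)·sin θ'` (`…PayerTransPlaneTwoPlate`).

THE RUNG, for RIGID fillings `X ⊆ Λ₁ ∪ Λ₂` (arbitrary occupancy): the deficit count
`Σ_window(12 − deg) ≥ 2φ₁·πρ² − O(ρ)` of `…IncoherentCount` (line tops of the six rising slot directions of `Λ₁`: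
every contact of a `Λ₁`-ball is on one of its twelve slots, so a top pays for each direction it tops; the walk is
kept below the complete top sample by the covering radius `< 1` of `Λ₂`) and the deficit ledger
`twoSlab_cross_le_of_deficit` (`…PayerAssembly`) give

* **`translate_twoSlabAdhesion_incoherent_rigid`** — the stub's inequality with adhesion term `φ₁ + φ₂ − φ₁`: the
  bottom grain's whole free surface is paid (no adhesion at all across an incoherent offset);
* **`coaxialTwoSlabAdhesion_classA_rigid`** — class (A) (all six `p_i ± p_j ∈ ℤ`, `p = √2·cubicCoords τ`), `Λ₁ ≠ Λ₂`,
  rigid fillings: the stub's inequality VERBATIM at `(1/2)·√(1 − ⟪L e₃, e₃⟫²)` for EVERY frame `L` (`2φ₁ ≥ 1`,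
  `two_phi_ge_one`).  Inputs: NONE.

With 19481-p1's `coaxialTwoSlabAdhesion_layered` (pairs with a common site lattice: twins and the fault-vector
translation cosets) this puts the RIGID two-lattice class at `½` for every co-axial pair whose offset is either a
site-lattice vector or incoherent — everything but the non-generic offsets in `(Λ₀ + S²) ∖ (site lattice)`.

WHAT THIS IS NOT: arbitrary fillings (third material can bond to both grains: the census-free record there is the word
lane's `φ₁/39`, `…PayerUnionTwoPlate`); the stub; F-C1 not moved.
-/

noncomputable section

namespace Summit.Ventures.Crystal3D.Theorems

open Summit.Ventures.Crystal3D Finset NearIdentity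
open Literature.MathematicalPhysics.StatisticalMechanics (fccStacking barlowStacking constHagg IsHaggSeq
  contactDeficiency)
open scoped InnerProductSpace

open scoped Classical in
/-- **Incoherent offset, rigid filling: the bottom grain recovers nothing.**  See the module docstring. -/
theorem translate_twoSlabAdhesion_incoherent_rigid
    (A₁ : EuclideanSpace ℝ (Fin 3) ≃ₗᵢ[ℝ] EuclideanSpace ℝ (Fin 3)) (t₁ : EuclideanSpace ℝ (Fin 3))
    (A₂ : EuclideanSpace ℝ (Fin 3) ≃ₗᵢ[ℝ] EuclideanSpace ℝ (Fin 3)) (t₂ : EuclideanSpace ℝ (Fin 3))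
    (htrans : A₁ '' fccStacking 1 (Real.sqrt (2 / 3)) = A₂ '' fccStacking 1 (Real.sqrt (2 / 3)))
    (hA : ∀ q ∈ fccStacking 1 (Real.sqrt (2 / 3)), ‖q + A₁.symm (t₂ - t₁)‖ ≠ 1) :
    ∃ C R₀ : ℝ, 1 ≤ R₀ ∧ ∀ h : ℝ, 0 ≤ h → ∀ ρ : ℝ, R₀ ≤ ρ →
      ∀ X P₁ P₂ : Finset (EuclideanSpace ℝ (Fin 3)),
      (∀ p ∈ X, ∀ q ∈ X, p ≠ q → 1 ≤ dist p q) → P₁ ⊆ X → P₂ ⊆ X \ P₁ →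
      (∀ p ∈ X, -(2 * R₀) ≤ p 2 ∧ p 2 ≤ h + 2 * R₀ ∧ p 0 ^ 2 + p 1 ^ 2 ≤ ρ ^ 2) →
      (∀ p, p ∈ P₁ ↔ (p ∈ (fun q => A₁ q + t₁) '' fccStacking 1 (Real.sqrt (2 / 3)) ∧
        -(2 * R₀) ≤ p 2 ∧ p 2 ≤ -R₀ ∧ p 0 ^ 2 + p 1 ^ 2 ≤ ρ ^ 2)) →
      (∀ p, p ∈ P₂ ↔ (p ∈ (fun q => A₂ q + t₂) '' fccStacking 1 (Real.sqrt (2 / 3)) ∧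
        h + R₀ ≤ p 2 ∧ p 2 ≤ h + 2 * R₀ ∧ p 0 ^ 2 + p 1 ^ 2 ≤ ρ ^ 2)) →
      (∀ x ∈ X, x ∈ (fun q => A₁ q + t₁) '' fccStacking 1 (Real.sqrt (2 / 3)) ∨
        x ∈ (fun q => A₂ q + t₂) '' fccStacking 1 (Real.sqrt (2 / 3))) →
      ((((P₁ ×ˢ (X \ P₁)).filter fun pq => dist pq.1 pq.2 = 1).card : ℕ) : ℝ) +
        ((((P₂ ×ˢ ((X \ P₁) \ P₂)).filter fun pq => dist pq.1 pq.2 = 1).card : ℕ) : ℝ) ≤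
        contactDeficiency ((X \ P₁) \ P₂) +
          (Real.sqrt 2 / 4 * ∑ᶠ w ∈ {w ∈ fccStacking 1 (Real.sqrt (2 / 3)) | ‖w‖ = 1},
              |⟪w, A₁.symm (EuclideanSpace.single (2 : Fin 3) (1 : ℝ))⟫_ℝ| +
            Real.sqrt 2 / 4 * ∑ᶠ w ∈ {w ∈ fccStacking 1 (Real.sqrt (2 / 3)) | ‖w‖ = 1},
              |⟪w, A₂.symm (EuclideanSpace.single (2 : Fin 3) (1 : ℝ))⟫_ℝ| -
            Real.sqrt 2 / 4 * ∑ᶠ w ∈ {w ∈ fccStacking 1 (Real.sqrt (2 / 3)) | ‖w‖ = 1},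
              |⟪w, A₁.symm (EuclideanSpace.single (2 : Fin 3) (1 : ℝ))⟫_ℝ|) * Real.pi * ρ ^ 2 +
          C * (1 + h) * ρ := by
  set φ₁ : ℝ := Real.sqrt 2 / 4 * ∑ᶠ w ∈ {w ∈ fccStacking 1 (Real.sqrt (2 / 3)) | ‖w‖ = 1},
      |⟪w, A₁.symm (EuclideanSpace.single (2 : Fin 3) (1 : ℝ))⟫_ℝ| with hφ₁
  -- the top grain in the bottom frame
  have hΛ₂ : (fun q => A₂ q + t₂) '' fccStacking 1 (Real.sqrt (2 / 3)) =
      (fun q => A₁ q + t₂) '' fccStacking 1 (Real.sqrt (2 / 3)) := by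
    have e2 : (fun q => A₂ q + t₂) '' fccStacking 1 (Real.sqrt (2 / 3)) =
        (fun y => y + t₂) '' (A₂ '' fccStacking 1 (Real.sqrt (2 / 3))) := by rw [Set.image_image]
    have e1 : (fun q => A₁ q + t₂) '' fccStacking 1 (Real.sqrt (2 / 3)) =
        (fun y => y + t₂) '' (A₁ '' fccStacking 1 (Real.sqrt (2 / 3))) := by rw [Set.image_image]
    rw [e2, e1, htrans]
  set K : ℝ := 12 * (12 * Real.sqrt 2 * Real.pi + 36 * 10 + 144) with hK
  have hK0 : 0 ≤ K := by positivity
  obtain ⟨C, hC⟩ := twoSlab_cross_le_of_deficit A₁ t₁ A₂ t₂ 10 le_rfl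
  refine ⟨C + K / 2, 10, by norm_num, ?_⟩
  intro h hh ρ hρ X P₁ P₂ hX hP₁X hP₂X₁ hcyl hP₁ hP₂ hrig
  have hP₂X : P₂ ⊆ X := hP₂X₁.trans sdiff_subset
  have hρ0 : (0 : ℝ) ≤ ρ := by linarith
  have hP₂' : ∀ p, p ∈ P₂ ↔ (p ∈ (fun q => A₁ q + t₂) '' fccStacking 1 (Real.sqrt (2 / 3)) ∧
      h + 10 ≤ p 2 ∧ p 2 ≤ h + 2 * 10 ∧ p 0 ^ 2 + p 1 ^ 2 ≤ ρ ^ 2) := by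
    intro p; rw [hP₂, hΛ₂]
  have hrig' : ∀ x ∈ X, x ∈ (fun q => A₁ q + t₁) '' fccStacking 1 (Real.sqrt (2 / 3)) ∨
      x ∈ (fun q => A₁ q + t₂) '' fccStacking 1 (Real.sqrt (2 / 3)) := by
    intro x hx; rw [← hΛ₂]; exact hrig x hx
  have hcount := translate_deficit_ge_incoherent_rigid A₁ t₁ t₂ hA X P₁ P₂ 10 h ρ le_rfl hh hρ hX hcyl hP₁X hP₂X
    hP₁ hP₂' hrig'
  rw [← hK, ← hφ₁] at hcount
  have hpay : 2 * φ₁ * Real.pi * ρ ^ 2 - K * (1 + h) * ρ ≤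
      ∑ z ∈ X.filter (fun z => -(10 : ℝ) - 2 ≤ z 2 ∧ z 2 ≤ h + 10 + 2),
        ((12 : ℝ) - ((X.filter fun q => dist z q = 1).card : ℝ)) := by
    have hKh : K * ρ ≤ K * (1 + h) * ρ := by
      have := mul_nonneg (mul_nonneg hK0 hh) hρ0; linarith only [this]
    linarith only [hcount, hKh]
  have key := hC h hh ρ hρ X P₁ P₂ hX hP₁X hP₂X₁ hcyl hP₁ hP₂ (2 * φ₁) K hK0 hpay
  have e : (2 * φ₁ : ℝ) / 2 = φ₁ := by ring
  rw [e] at key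
  exact key

open scoped Classical in
/-- **CLASS (A) TRANSLATION PAIRS, RIGID FILLINGS: THE STUB'S INEQUALITY AT `½·sin θ` FOR EVERY AXIS.**  The offset
`τ = A₁⁻¹(t₂ − t₁)` has all six `p_i ± p_j ∈ ℤ` (`p = √2·cubicCoords τ`) and the grains differ; every filling on
`Λ₁ ∪ Λ₂` obeys `stub_coaxialTwoSlabAdhesion`'s inequality with `(1/2)·√(1 − ⟪L e₃, e₃⟫²)` for every frame `L`.
Inputs: none.  See the module docstring. -/
theorem coaxialTwoSlabAdhesion_classA_rigid
    (A₁ : EuclideanSpace ℝ (Fin 3) ≃ₗᵢ[ℝ] EuclideanSpace ℝ (Fin 3)) (t₁ : EuclideanSpace ℝ (Fin 3))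
    (A₂ : EuclideanSpace ℝ (Fin 3) ≃ₗᵢ[ℝ] EuclideanSpace ℝ (Fin 3)) (t₂ : EuclideanSpace ℝ (Fin 3))
    (htrans : A₁ '' fccStacking 1 (Real.sqrt (2 / 3)) = A₂ '' fccStacking 1 (Real.sqrt (2 / 3)))
    (hne : (fun p => A₁ p + t₁) '' fccStacking 1 (Real.sqrt (2 / 3)) ≠
      (fun p => A₂ p + t₂) '' fccStacking 1 (Real.sqrt (2 / 3)))
    (hall : ∀ i j : Fin 3, i ≠ j →
      (∃ z : ℤ, Real.sqrt 2 * cubicCoords (A₁.symm (t₂ - t₁)) i +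
          Real.sqrt 2 * cubicCoords (A₁.symm (t₂ - t₁)) j = z) ∧
      (∃ z : ℤ, Real.sqrt 2 * cubicCoords (A₁.symm (t₂ - t₁)) i -
          Real.sqrt 2 * cubicCoords (A₁.symm (t₂ - t₁)) j = z))
    (L : EuclideanSpace ℝ (Fin 3) ≃ₗᵢ[ℝ] EuclideanSpace ℝ (Fin 3)) :
    ∃ C R₀ : ℝ, 1 ≤ R₀ ∧ ∀ h : ℝ, 0 ≤ h → ∀ ρ : ℝ, R₀ ≤ ρ →
      ∀ X P₁ P₂ : Finset (EuclideanSpace ℝ (Fin 3)),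
      (∀ p ∈ X, ∀ q ∈ X, p ≠ q → 1 ≤ dist p q) → P₁ ⊆ X → P₂ ⊆ X \ P₁ →
      (∀ p ∈ X, -(2 * R₀) ≤ p 2 ∧ p 2 ≤ h + 2 * R₀ ∧ p 0 ^ 2 + p 1 ^ 2 ≤ ρ ^ 2) →
      (∀ p, p ∈ P₁ ↔ (p ∈ (fun q => A₁ q + t₁) '' fccStacking 1 (Real.sqrt (2 / 3)) ∧
        -(2 * R₀) ≤ p 2 ∧ p 2 ≤ -R₀ ∧ p 0 ^ 2 + p 1 ^ 2 ≤ ρ ^ 2)) →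
      (∀ p, p ∈ P₂ ↔ (p ∈ (fun q => A₂ q + t₂) '' fccStacking 1 (Real.sqrt (2 / 3)) ∧
        h + R₀ ≤ p 2 ∧ p 2 ≤ h + 2 * R₀ ∧ p 0 ^ 2 + p 1 ^ 2 ≤ ρ ^ 2)) →
      (∀ x ∈ X, x ∈ (fun q => A₁ q + t₁) '' fccStacking 1 (Real.sqrt (2 / 3)) ∨
        x ∈ (fun q => A₂ q + t₂) '' fccStacking 1 (Real.sqrt (2 / 3))) →
      ((((P₁ ×ˢ (X \ P₁)).filter fun pq => dist pq.1 pq.2 = 1).card : ℕ) : ℝ) +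
        ((((P₂ ×ˢ ((X \ P₁) \ P₂)).filter fun pq => dist pq.1 pq.2 = 1).card : ℕ) : ℝ) ≤
        contactDeficiency ((X \ P₁) \ P₂) +
          (Real.sqrt 2 / 4 * ∑ᶠ w ∈ {w ∈ fccStacking 1 (Real.sqrt (2 / 3)) | ‖w‖ = 1},
              |⟪w, A₁.symm (EuclideanSpace.single (2 : Fin 3) (1 : ℝ))⟫_ℝ| +
            Real.sqrt 2 / 4 * ∑ᶠ w ∈ {w ∈ fccStacking 1 (Real.sqrt (2 / 3)) | ‖w‖ = 1},
              |⟪w, A₂.symm (EuclideanSpace.single (2 : Fin 3) (1 : ℝ))⟫_ℝ| -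
            (1 / 2 : ℝ) * Real.sqrt (1 - ⟪L (EuclideanSpace.single (2 : Fin 3) (1 : ℝ)),
              (EuclideanSpace.single (2 : Fin 3) (1 : ℝ))⟫_ℝ ^ 2)) * Real.pi * ρ ^ 2 +
          C * (1 + h) * ρ := by
  set e₃ : EuclideanSpace ℝ (Fin 3) := EuclideanSpace.single (2 : Fin 3) (1 : ℝ) with he₃
  set τ : EuclideanSpace ℝ (Fin 3) := A₁.symm (t₂ - t₁) with hτ
  have hτΛ : τ ∉ fccStacking 1 (Real.sqrt (2 / 3)) := offset_notMem_of_ne A₁ A₂ t₁ t₂ htrans hne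
  have hA : ∀ q ∈ fccStacking 1 (Real.sqrt (2 / 3)), ‖q + A₁.symm (t₂ - t₁)‖ ≠ 1 :=
    allInt_norm_add_ne_one τ hall hτΛ
  obtain ⟨C, R₀, hR₀, hmain⟩ := translate_twoSlabAdhesion_incoherent_rigid A₁ t₁ A₂ t₂ htrans hA
  refine ⟨C, R₀, hR₀, ?_⟩
  intro h hh ρ hρ X P₁ P₂ hX hP₁X hP₂X₁ hcyl hP₁ hP₂ hrig
  have key := hmain h hh ρ hρ X P₁ P₂ hX hP₁X hP₂X₁ hcyl hP₁ hP₂ hrig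
  -- `(1/2)·sin θ ≤ 1/2 ≤ φ₁`
  have hsin : Real.sqrt (1 - ⟪L e₃, e₃⟫_ℝ ^ 2) ≤ 1 := by
    rw [show (1 : ℝ) = Real.sqrt 1 from Real.sqrt_one.symm]
    exact Real.sqrt_le_sqrt (by rw [Real.sqrt_one]; nlinarith [sq_nonneg ⟪L e₃, e₃⟫_ℝ])
  have hphi := two_phi_ge_one A₁
  have hc' : (1 / 2 : ℝ) * Real.sqrt (1 - ⟪L e₃, e₃⟫_ℝ ^ 2) ≤
      Real.sqrt 2 / 4 * ∑ᶠ w ∈ {w ∈ fccStacking 1 (Real.sqrt (2 / 3)) | ‖w‖ = 1}, |⟪w, A₁.symm e₃⟫_ℝ| := by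
    linarith only [hsin, hphi]
  have hπρ : 0 ≤ Real.pi * ρ ^ 2 := by positivity
  have := mul_le_mul_of_nonneg_right hc' hπρ
  linarith only [key, this]

end Summit.Ventures.Crystal3D.Theorems

end
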